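import Summits.RiemannHypothesis.RiemannHypothesis.Theorems.TiltedLandingLaw421R3NewtonDoor3

open Complex Set
open scoped ComplexConjugate
open Literature.Analysis.Complex
open Summit.RiemannHypothesis.RiemannHypothesis.Theorems.Splittings.JensenWindow
open RhIdea6.G17.W07C7 RhIdea6.G17.W07C7.Rev6 RhIdea6.G18.W07C8.Law421BirthS RhIdea6.G19.W07C11.Seam
open RhIdea6.G20.W07C12.Frac RhIdea6.G20.W07C12.StColP RhW07.C12.FieldSplit RhIdea6.G21.W07C13.TentMax
open RhW07.C14.TwoSided RhW07.C14.Classes RhW07.C14.Lineage RhW07.C14.Booking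
open RhW07.C13.Heredity RhIdea6.G22.W07C15pre.Injection RhW07.E3.Cell RhW07.E3.Lit
open RhW08.Round1 RhW08.StSwap RhW08.Round2 RhW08.QuadW RhW08.SealSwapQ RhW08.SuccB RhW08.SuccSplit RhW08.SuccTheft
open RhW08.Column RhW08.Hurwitz
open RhW08.ClusterQ RhW08.ClusterQM

/-!
# W-08 NewtonDoor Part 4/4 — Exact doors and two-point forms

Split from `NewtonDoor-W08-C1-rh-idea-5-g28.lean` (v17 ad5354c4).
Contains: `succ_of_newton_door_twoPoint'`, `succ_of_newton_door_twoPointU`, `succ_of_newton_door_polyexp`,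
`succ_of_newton_door_landau`.
-/

namespace RhW08.NewtonDoor

/-! ## The EXACT door for a finite zero set × exponential (the census frames; finite model of the genus-one route of C3 g41 RESULT-4) -/

/-- If `F = (· − v)·h` with `h` differentiable at `v`, then `dslope F v = h` (as functions). -/
theorem dslope_eq_of_factor {F h : ℂ → ℂ} {v : ℂ} (hfac : ∀ z, F z = (z - v) * h z) (hh : DifferentiableAt ℂ h v) : dslope F v = h := by
  have hFv : F v = 0 := by rw [hfac v, sub_self, zero_mul]
  funext z
  by_cases hz : z = v
  · subst hz
    rw [dslope_same]
    have hF : F = fun w => (w - z) * h w := funext hfac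
    rw [hF]
    have h1 : DifferentiableAt ℂ (fun w : ℂ => w - z) z := by fun_prop
    have := deriv_mul (c := fun w : ℂ => w - z) (d := h) h1 hh
    simp only [Pi.mul_def] at this ⊢
    rw [show (fun w : ℂ => (w - z) * h w) = ((fun w : ℂ => w - z) * h) from rfl] at *
    rw [deriv_mul h1 hh]
    simp
  · rw [dslope_of_ne F hz, slope_def_field, hFv, sub_zero, hfac z]
    field_simp [sub_ne_zero.mpr hz]

/-- ★ THE EXACT NEWTON DOOR for `F = f^{(j)} = (∏_{a∈S}(· − a)^{m_a})·e^{A + γ·z}` (finite zero set × exponential — the census frames, and the finite model of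
the genus-one two-point identity): with the CANONICAL FIELD `K = Σ_{a∈S∖{v}} m_a/(v − a) + γ` (`= h′(v)/h(v)`), `v ∈ S` simple, every other zero
farther than `r_N = (1+ρ₀)/‖K‖` from `v`, and the single END CONDITION `(1+ρ₀)·r_N·Σ_{a≠v} m_a/((‖v − a‖ − r_N)‖v − a‖) < ρ₀‖K‖` (no radii, no far
field: the exponential factor cancels in the difference `h′/h(z) − h′/h(v)`), plus the off-axis and slack clauses ⇒ `v` has a successor. -/
theorem succ_of_newton_door_polyexp {η : ℝ} {f : ℂ → ℂ} {x₀ s hmax R Hs : ℝ} {B j : ℕ} {v : ℂ} (hE : EngineHyps5 2 η f x₀ s hmax R Hs B)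
    (hv : StTrkDQ η f x₀ s hmax R Hs B j v) {S : Finset ℂ} {m : ℂ → ℕ} {A γ : ℂ}
    (hF : ∀ z, iteratedDeriv j f z = (∏ a ∈ S, (z - a) ^ (m a)) * Complex.exp (A + γ * z)) (hvS : v ∈ S) (hmv : m v = 1)
    {K : ℂ} (hKdef : K = ∑ a ∈ S.erase v, ((m a : ℕ) : ℂ) / (v - a) + γ) (hK : K ≠ 0) (hKy : 1 < ‖K‖ * v.im)
    {ρ₀ : ℝ} (hρ₀ : 0 < ρ₀) (hoff : ρ₀ / ‖K‖ ≤ |(v - K⁻¹).im|)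
    (hsep : ∀ a ∈ S.erase v, (1 + ρ₀) / ‖K‖ < ‖v - a‖)
    (hend : (1 + ρ₀) * ((1 + ρ₀) / ‖K‖ * ∑ a ∈ S.erase v, (m a : ℝ) / ((‖v - a‖ - (1 + ρ₀) / ‖K‖) * ‖v - a‖)) < ρ₀ * ‖K‖)
    (hslack : (rhoN x₀ R v + (1 + ρ₀) / ‖K‖) ^ 2 + ((j : ℝ) + 1) * (v.im + (1 + ρ₀) / ‖K‖) ^ 2 ≤ ((j : ℝ) + 1) * Hs ^ 2) :
    ∃ u : ℂ, StTrkDQ η f x₀ s hmax R Hs B (j + 1) u := by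
  classical
  -- the cofactor h = P_v · e^{A + γ z}
  set G : ℂ → ℂ := fun z => Complex.exp (A + γ * z) with hGdef
  set h : ℂ → ℂ := fun z => (∏ a ∈ S.erase v, (z - a) ^ (m a)) * G z with hhdef
  have hGd : Differentiable ℂ G := by simp only [hGdef]; fun_prop
  have hG0 : ∀ z, G z ≠ 0 := fun z => Complex.exp_ne_zero _
  have hGlog : ∀ z, deriv G z / G z = γ := by
    intro z
    have hd : deriv G z = γ * G z := by
      simp only [hGdef]
      have : HasDerivAt (fun w : ℂ => A + γ * w) γ z := by
        simpa using ((hasDerivAt_id z).const_mul γ).const_add A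
      rw [(this.cexp).deriv]; ring
    rw [hd, mul_div_assoc, div_self (hG0 z), mul_one]
  have hhd : Differentiable ℂ h := by simp only [hhdef, hGdef]; fun_prop
  have hfac : ∀ z, iteratedDeriv j f z = (z - v) * h z := by
    intro z
    rw [hF z, hhdef]
    simp only []
    rw [← Finset.mul_prod_erase S (fun a => (z - a) ^ (m a)) hvS, hmv, pow_one, mul_assoc]
  have hds : dslope (iteratedDeriv j f) v = h := dslope_eq_of_factor hfac (hhd v)
  have hKn : 0 < ‖K‖ := norm_pos_iff.mpr hK
  set rN : ℝ := (1 + ρ₀) / ‖K‖ with hrN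
  -- h is zero-free on the closed Newton disc (its zeros are S ∖ {v}, all farther than r_N from v)
  have hh0 : ∀ z : ℂ, ‖z - (v - K⁻¹)‖ ≤ ρ₀ / ‖K‖ → h z ≠ 0 := by
    intro z hz
    have hzv : ‖z - v‖ ≤ rN := norm_sub_le_of_newtonDisc hK hz
    have hza : ∀ a ∈ S.erase v, z ≠ a := by
      intro a ha hza
      have := hsep a ha
      rw [hza] at hzv
      have : ‖v - a‖ = ‖a - v‖ := norm_sub_rev _ _
      linarith
    simp only [hhdef]
    exact mul_ne_zero (Finset.prod_ne_zero_iff.mpr fun a ha => pow_ne_zero _ (sub_ne_zero.mpr (hza a ha))) (hG0 z)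
  -- the field identity everywhere off S ∖ {v}
  have hfield : ∀ z, (∀ a ∈ S.erase v, z ≠ a) → deriv h z / h z = ∑ a ∈ S.erase v, ((m a : ℕ) : ℂ) / (z - a) + γ := by
    intro z hz
    rw [← hGlog z]
    exact field_split (S.erase v) m hz (hGd z) (hG0 z) (Filter.Eventually.of_forall fun w => rfl)
  have hvoff : ∀ a ∈ S.erase v, v ≠ a := by
    intro a ha hva
    have := hsep a ha
    rw [hva, sub_self, norm_zero] at this
    have : 0 < (1 + ρ₀) / ‖K‖ := by positivity
    linarith
  -- the Lipschitz bound on the circle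
  have hlip : ∀ z : ℂ, ‖z - (v - K⁻¹)‖ = ρ₀ / ‖K‖ → ‖deriv h z / h z - K‖ ≤
      (1 + ρ₀) / ‖K‖ * ∑ a ∈ S.erase v, (m a : ℝ) / ((‖v - a‖ - (1 + ρ₀) / ‖K‖) * ‖v - a‖) := by
    intro z hz
    have hzv : ‖z - v‖ ≤ rN := norm_sub_le_of_newtonDisc hK (le_of_eq hz)
    have hza : ∀ a ∈ S.erase v, z ≠ a := by
      intro a ha hza
      have := hsep a ha
      rw [hza] at hzv
      have : ‖v - a‖ = ‖a - v‖ := norm_sub_rev _ _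
      linarith
    have hcast : ∀ a, ((m a : ℕ) : ℂ) = (((m a : ℕ) : ℝ) : ℂ) := fun a => by push_cast; rfl
    have h1 := nearSum_variation (S.erase v) (fun a => ((m a : ℕ) : ℝ)) (fun a _ => Nat.cast_nonneg _) hza hvoff
    have hdiff : deriv h z / h z - K =
        ∑ a ∈ S.erase v, ((((m a : ℕ) : ℝ)) : ℂ) / (z - a) - ∑ a ∈ S.erase v, ((((m a : ℕ) : ℝ)) : ℂ) / (v - a) := by
      rw [hfield z hza, hKdef]; simp only [hcast]; ring
    rw [hdiff]
    refine le_trans h1 ?_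
    -- termwise: ‖z − v‖·m_a/(‖z − a‖‖v − a‖) ≤ r_N·m_a/((‖v − a‖ − r_N)‖v − a‖)
    rw [Finset.mul_sum, Finset.mul_sum]
    refine Finset.sum_le_sum fun a ha => ?_
    have hsa := hsep a ha
    have hva0 : 0 < ‖v - a‖ := lt_trans (by positivity) hsa
    have hza' : ‖v - a‖ - rN ≤ ‖z - a‖ := by
      have : ‖v - a‖ ≤ ‖v - z‖ + ‖z - a‖ := norm_sub_le_norm_sub_add_norm_sub _ _ _
      rw [norm_sub_rev v z] at this
      linarith
    have hden0 : 0 < (‖v - a‖ - rN) * ‖v - a‖ := mul_pos (by linarith) hva0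
    have hma : (0 : ℝ) ≤ ((m a : ℕ) : ℝ) := Nat.cast_nonneg _
    calc ‖z - v‖ * (((m a : ℕ) : ℝ) / (‖z - a‖ * ‖v - a‖))
        ≤ rN * (((m a : ℕ) : ℝ) / (‖z - a‖ * ‖v - a‖)) :=
          mul_le_mul_of_nonneg_right hzv (div_nonneg hma (mul_nonneg (norm_nonneg _) (norm_nonneg _)))
      _ ≤ rN * (((m a : ℕ) : ℝ) / ((‖v - a‖ - rN) * ‖v - a‖)) := by
          apply mul_le_mul_of_nonneg_left _ (by positivity)
          exact div_le_div_of_nonneg_left hma hden0 (mul_le_mul_of_nonneg_right hza' (norm_nonneg _))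
  -- conclude through the Lipschitz door
  have hh0' : ∀ z : ℂ, ‖z - (v - K⁻¹)‖ ≤ ρ₀ / ‖K‖ → dslope (iteratedDeriv j f) v z ≠ 0 := by rw [hds]; exact hh0
  have hlip' : ∀ z : ℂ, ‖z - (v - K⁻¹)‖ = ρ₀ / ‖K‖ →
      ‖deriv (dslope (iteratedDeriv j f) v) z / dslope (iteratedDeriv j f) v z - K‖ ≤
        (1 + ρ₀) / ‖K‖ * ∑ a ∈ S.erase v, (m a : ℝ) / ((‖v - a‖ - (1 + ρ₀) / ‖K‖) * ‖v - a‖) := by rw [hds]; exact hlip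
  exact succ_of_newton_door_lip hE hv hK hKy hρ₀ hend hoff hh0' hlip' hslack

/-! ## The EXACT door in SERIES form (interface for the genus-one two-point identity of C3 g41: any countable zero list) -/

/-- Termwise variation of a (possibly infinite) zero sum on the Newton circle: if `‖z − v‖ ≤ r`, every `a i` is farther than
`r` from `v`, and `Σ' m_i/((‖v − a_i‖ − r)‖v − a_i‖)` converges, then `Σ' m_i·(1/(z − a_i) − 1/(v − a_i))` converges and has
norm `≤ r · Σ' m_i/((‖v − a_i‖ − r)‖v − a_i‖)`. -/
theorem tsum_variation {ι : Type*} (a : ι → ℂ) (m : ι → ℝ) (hm : ∀ i, 0 ≤ m i) {z v : ℂ} {r : ℝ}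
    (hzv : ‖z - v‖ ≤ r) (hsep : ∀ i, r < ‖v - a i‖)
    (hS : Summable fun i => m i / ((‖v - a i‖ - r) * ‖v - a i‖)) :
    Summable (fun i => (m i : ℂ) * (1 / (z - a i) - 1 / (v - a i))) ∧
      ‖∑' i, (m i : ℂ) * (1 / (z - a i) - 1 / (v - a i))‖ ≤ r * ∑' i, m i / ((‖v - a i‖ - r) * ‖v - a i‖) := by
  have hr : 0 ≤ r := le_trans (norm_nonneg _) hzv
  have hterm : ∀ i, ‖(m i : ℂ) * (1 / (z - a i) - 1 / (v - a i))‖ ≤ r * (m i / ((‖v - a i‖ - r) * ‖v - a i‖)) := by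
    intro i
    have hsa := hsep i
    have hva0 : 0 < ‖v - a i‖ := lt_of_le_of_lt hr hsa
    have hza' : ‖v - a i‖ - r ≤ ‖z - a i‖ := by
      have : ‖v - a i‖ ≤ ‖v - z‖ + ‖z - a i‖ := norm_sub_le_norm_sub_add_norm_sub _ _ _
      rw [norm_sub_rev v z] at this
      linarith
    have hza0 : 0 < ‖z - a i‖ := lt_of_lt_of_le (by linarith) hza'
    have hzne : z - a i ≠ 0 := norm_pos_iff.mp hza0
    have hvne : v - a i ≠ 0 := norm_pos_iff.mp hva0
    have hid : (m i : ℂ) * (1 / (z - a i) - 1 / (v - a i)) = (m i : ℂ) * (v - z) / ((z - a i) * (v - a i)) := by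
      field_simp
      ring
    rw [hid, norm_div, norm_mul, norm_mul, Complex.norm_real, Real.norm_of_nonneg (hm i), norm_sub_rev v z]
    have hden0 : 0 < (‖v - a i‖ - r) * ‖v - a i‖ := mul_pos (by linarith) hva0
    rw [div_le_iff₀ (mul_pos hza0 hva0)]
    calc m i * ‖z - v‖ ≤ m i * r := mul_le_mul_of_nonneg_left hzv (hm i)
      _ = r * (m i / ((‖v - a i‖ - r) * ‖v - a i‖)) * ((‖v - a i‖ - r) * ‖v - a i‖) := by
          have hne : ‖v - a i‖ - r ≠ 0 := ne_of_gt (by linarith)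
          field_simp
      _ ≤ r * (m i / ((‖v - a i‖ - r) * ‖v - a i‖)) * (‖z - a i‖ * ‖v - a i‖) := by
          apply mul_le_mul_of_nonneg_left (mul_le_mul_of_nonneg_right hza' (norm_nonneg _))
          exact mul_nonneg hr (div_nonneg (hm i) hden0.le)
  have hg : Summable fun i => r * (m i / ((‖v - a i‖ - r) * ‖v - a i‖)) := hS.mul_left r
  refine ⟨Summable.of_norm_bounded hg hterm, ?_⟩
  have := tsum_of_norm_bounded (hg.hasSum) hterm
  rw [hS.tsum_mul_left r] at this
  exact this

/-- ★ THE EXACT NEWTON DOOR, SERIES FORM.  `F = f^{(j)}`, `h = dslope F v`, canonical `K = h′(v)/h(v)` implicit in the TWO-POINT IDENTITY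
hypothesis `h′/h(z) − K = Σ' m_i (1/(z − a_i) − 1/(v − a_i))` on the Newton circle (this is what the genus-one Hadamard product gives for
order < 2: the exponential factor cancels — C3 g41 RESULT-4 §3, being typed as `GenusOneLogDeriv`), every listed zero farther than
`r_N = (1+ρ₀)/‖K‖` from `v`, and the single END CONDITION `(1+ρ₀)·r_N·Σ' m_i/((‖v − a_i‖ − r_N)‖v − a_i‖) < ρ₀‖K‖` (+ off-axis, zero-free
disc, slack) ⇒ `v` has a successor. -/
theorem succ_of_newton_door_tsum {η : ℝ} {f : ℂ → ℂ} {x₀ s hmax R Hs : ℝ} {B j : ℕ} {v : ℂ} (hE : EngineHyps5 2 η f x₀ s hmax R Hs B)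
    (hv : StTrkDQ η f x₀ s hmax R Hs B j v) {K : ℂ} (hK : K ≠ 0) (hKy : 1 < ‖K‖ * v.im)
    {ρ₀ : ℝ} (hρ₀ : 0 < ρ₀) (hoff : ρ₀ / ‖K‖ ≤ |(v - K⁻¹).im|)
    (hh0 : ∀ z : ℂ, ‖z - (v - K⁻¹)‖ ≤ ρ₀ / ‖K‖ → dslope (iteratedDeriv j f) v z ≠ 0)
    {ι : Type*} (a : ι → ℂ) (m : ι → ℝ) (hm : ∀ i, 0 ≤ m i)
    (hident : ∀ z : ℂ, ‖z - (v - K⁻¹)‖ = ρ₀ / ‖K‖ →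
      deriv (dslope (iteratedDeriv j f) v) z / dslope (iteratedDeriv j f) v z - K = ∑' i, (m i : ℂ) * (1 / (z - a i) - 1 / (v - a i)))
    (hsep : ∀ i, (1 + ρ₀) / ‖K‖ < ‖v - a i‖)
    (hS : Summable fun i => m i / ((‖v - a i‖ - (1 + ρ₀) / ‖K‖) * ‖v - a i‖))
    (hend : (1 + ρ₀) * ((1 + ρ₀) / ‖K‖ * ∑' i, m i / ((‖v - a i‖ - (1 + ρ₀) / ‖K‖) * ‖v - a i‖)) < ρ₀ * ‖K‖)
    (hslack : (rhoN x₀ R v + (1 + ρ₀) / ‖K‖) ^ 2 + ((j : ℝ) + 1) * (v.im + (1 + ρ₀) / ‖K‖) ^ 2 ≤ ((j : ℝ) + 1) * Hs ^ 2) :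
    ∃ u : ℂ, StTrkDQ η f x₀ s hmax R Hs B (j + 1) u := by
  refine succ_of_newton_door_lip hE hv hK hKy hρ₀ hend hoff hh0 ?_ hslack
  intro z hz
  rw [hident z hz]
  exact (tsum_variation a m hm (norm_sub_le_of_newtonDisc hK (le_of_eq hz)) hsep hS).2

/-- Termwise comparison of the z-dependent two-point majorant with the z-free one on the Newton circle:
`‖z − v‖ ≤ r`, `r < ‖v − a_i‖` ⇒ `‖z − v‖·Σ' m_i/(‖z − a_i‖‖v − a_i‖) ≤ r·Σ' m_i/((‖v − a_i‖ − r)‖v − a_i‖)` (the right side summable). -/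
theorem tsum_twoPoint_le {ι : Type*} (a : ι → ℂ) (m : ι → ℝ) (hm : ∀ i, 0 ≤ m i) {z v : ℂ} {r : ℝ}
    (hzv : ‖z - v‖ ≤ r) (hsep : ∀ i, 0 < m i → r < ‖v - a i‖)
    (hS : Summable fun i => m i / ((‖v - a i‖ - r) * ‖v - a i‖)) :
    ‖z - v‖ * ∑' i, m i / (‖z - a i‖ * ‖v - a i‖) ≤ r * ∑' i, m i / ((‖v - a i‖ - r) * ‖v - a i‖) := by
  have hr : 0 ≤ r := le_trans (norm_nonneg _) hzv
  have hterm : ∀ i, m i / (‖z - a i‖ * ‖v - a i‖) ≤ m i / ((‖v - a i‖ - r) * ‖v - a i‖) := by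
    intro i
    rcases (hm i).eq_or_lt with hmi | hmi
    · rw [← hmi]; simp
    have hsa := hsep i hmi
    have hva0 : 0 < ‖v - a i‖ := lt_of_le_of_lt hr hsa
    have hza' : ‖v - a i‖ - r ≤ ‖z - a i‖ := by
      have : ‖v - a i‖ ≤ ‖v - z‖ + ‖z - a i‖ := norm_sub_le_norm_sub_add_norm_sub _ _ _
      rw [norm_sub_rev v z] at this
      linarith
    have hden0 : 0 < (‖v - a i‖ - r) * ‖v - a i‖ := mul_pos (by linarith) hva0
    exact div_le_div_of_nonneg_left (hm i) hden0 (mul_le_mul_of_nonneg_right hza' (norm_nonneg _))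
  have hnn : ∀ i, 0 ≤ m i / (‖z - a i‖ * ‖v - a i‖) := fun i =>
    div_nonneg (hm i) (mul_nonneg (norm_nonneg _) (norm_nonneg _))
  have hS' : Summable fun i => m i / (‖z - a i‖ * ‖v - a i‖) := Summable.of_nonneg_of_le hnn hterm hS
  have h1 : ∑' i, m i / (‖z - a i‖ * ‖v - a i‖) ≤ ∑' i, m i / ((‖v - a i‖ - r) * ‖v - a i‖) :=
    Summable.tsum_le_tsum hterm hS' hS
  have h0 : 0 ≤ ∑' i, m i / (‖z - a i‖ * ‖v - a i‖) := tsum_nonneg hnn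
  calc ‖z - v‖ * ∑' i, m i / (‖z - a i‖ * ‖v - a i‖) ≤ r * ∑' i, m i / (‖z - a i‖ * ‖v - a i‖) :=
        mul_le_mul_of_nonneg_right hzv h0
    _ ≤ r * ∑' i, m i / ((‖v - a i‖ - r) * ‖v - a i‖) := mul_le_mul_of_nonneg_left h1 hr

/-- ★ THE EXACT NEWTON DOOR, TWO-POINT-BOUND FORM (matches C3 g41 RESULT-5 `norm_logDeriv_sub_logDeriv_le` in zero coordinates): the
HYPOTHESIS is the z-dependent Lipschitz bound `‖h′/h(z) − K‖ ≤ ‖z − v‖·Σ' m_i/(‖z − a_i‖‖v − a_i‖)` on the Newton circle (`K = h′/h(v)`,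
`h = dslope f^{(j)} v`, `a_i` the other zeros with weights `m_i ≥ 0`), plus separation `r_N < ‖v − a_i‖`, summability and the single END
CONDITION `(1+ρ₀)·r_N·Σ' m_i/((‖v − a_i‖ − r_N)‖v − a_i‖) < ρ₀‖K‖` (+ off-axis, zero-free disc, slack) ⇒ `v` has a successor. -/
theorem succ_of_newton_door_twoPoint {η : ℝ} {f : ℂ → ℂ} {x₀ s hmax R Hs : ℝ} {B j : ℕ} {v : ℂ} (hE : EngineHyps5 2 η f x₀ s hmax R Hs B)
    (hv : StTrkDQ η f x₀ s hmax R Hs B j v) {K : ℂ} (hK : K ≠ 0) (hKy : 1 < ‖K‖ * v.im)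
    {ρ₀ : ℝ} (hρ₀ : 0 < ρ₀) (hoff : ρ₀ / ‖K‖ ≤ |(v - K⁻¹).im|)
    (hh0 : ∀ z : ℂ, ‖z - (v - K⁻¹)‖ ≤ ρ₀ / ‖K‖ → dslope (iteratedDeriv j f) v z ≠ 0)
    {ι : Type*} (a : ι → ℂ) (m : ι → ℝ) (hm : ∀ i, 0 ≤ m i)
    (hineq : ∀ z : ℂ, ‖z - (v - K⁻¹)‖ = ρ₀ / ‖K‖ →
      ‖deriv (dslope (iteratedDeriv j f) v) z / dslope (iteratedDeriv j f) v z - K‖ ≤ ‖z - v‖ * ∑' i, m i / (‖z - a i‖ * ‖v - a i‖))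
    (hsep : ∀ i, 0 < m i → (1 + ρ₀) / ‖K‖ < ‖v - a i‖)
    (hS : Summable fun i => m i / ((‖v - a i‖ - (1 + ρ₀) / ‖K‖) * ‖v - a i‖))
    (hend : (1 + ρ₀) * ((1 + ρ₀) / ‖K‖ * ∑' i, m i / ((‖v - a i‖ - (1 + ρ₀) / ‖K‖) * ‖v - a i‖)) < ρ₀ * ‖K‖)
    (hslack : (rhoN x₀ R v + (1 + ρ₀) / ‖K‖) ^ 2 + ((j : ℝ) + 1) * (v.im + (1 + ρ₀) / ‖K‖) ^ 2 ≤ ((j : ℝ) + 1) * Hs ^ 2) :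
    ∃ u : ℂ, StTrkDQ η f x₀ s hmax R Hs B (j + 1) u := by
  refine succ_of_newton_door_lip hE hv hK hKy hρ₀ hend hoff hh0 ?_ hslack
  intro z hz
  exact le_trans (hineq z hz) (tsum_twoPoint_le a m hm (norm_sub_le_of_newtonDisc hK (le_of_eq hz)) hsep hS)

/-- Zero-freeness of the cofactor on the closed Newton disc from a COMPLETE WEIGHTED zero list and separation: if every zero of `h` is some
`a i` with positive weight and each positively-weighted `a i` is farther than `r_N = (1+ρ₀)/‖K‖` from `v`, then `h ≠ 0` on `‖z − (v − K⁻¹)‖ ≤ ρ₀/‖K‖`. -/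
theorem cofactor_ne_zero_of_separated {h : ℂ → ℂ} {K v : ℂ} (hK : K ≠ 0) {ρ₀ : ℝ} {ι : Type*} (a : ι → ℂ) (m : ι → ℝ)
    (hzeros : ∀ z, h z = 0 → ∃ i, z = a i ∧ 0 < m i) (hsep : ∀ i, 0 < m i → (1 + ρ₀) / ‖K‖ < ‖v - a i‖) :
    ∀ z : ℂ, ‖z - (v - K⁻¹)‖ ≤ ρ₀ / ‖K‖ → h z ≠ 0 := by
  intro z hz hz0
  obtain ⟨i, rfl, hmi⟩ := hzeros z hz0
  have h1 : ‖a i - v‖ ≤ (1 + ρ₀) / ‖K‖ := norm_sub_le_of_newtonDisc hK hz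
  have h2 := hsep i hmi
  rw [norm_sub_rev] at h2
  linarith

/-- ★ `succ_of_newton_door_twoPoint` with the zero-free-disc clause DISCHARGED from a complete zero list (`hzeros`) + separation — the form the
hands instantiate from C3 g41's `exists_twoPoint_bound` (whose `ncard` clause makes the list complete). -/
theorem succ_of_newton_door_twoPoint' {η : ℝ} {f : ℂ → ℂ} {x₀ s hmax R Hs : ℝ} {B j : ℕ} {v : ℂ} (hE : EngineHyps5 2 η f x₀ s hmax R Hs B)
    (hv : StTrkDQ η f x₀ s hmax R Hs B j v) {K : ℂ} (hK : K ≠ 0) (hKy : 1 < ‖K‖ * v.im)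
    {ρ₀ : ℝ} (hρ₀ : 0 < ρ₀) (hoff : ρ₀ / ‖K‖ ≤ |(v - K⁻¹).im|)
    {ι : Type*} (a : ι → ℂ) (m : ι → ℝ) (hm : ∀ i, 0 ≤ m i)
    (hzeros : ∀ z, dslope (iteratedDeriv j f) v z = 0 → ∃ i, z = a i ∧ 0 < m i)
    (hineq : ∀ z : ℂ, ‖z - (v - K⁻¹)‖ = ρ₀ / ‖K‖ →
      ‖deriv (dslope (iteratedDeriv j f) v) z / dslope (iteratedDeriv j f) v z - K‖ ≤ ‖z - v‖ * ∑' i, m i / (‖z - a i‖ * ‖v - a i‖))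
    (hsep : ∀ i, 0 < m i → (1 + ρ₀) / ‖K‖ < ‖v - a i‖)
    (hS : Summable fun i => m i / ((‖v - a i‖ - (1 + ρ₀) / ‖K‖) * ‖v - a i‖))
    (hend : (1 + ρ₀) * ((1 + ρ₀) / ‖K‖ * ∑' i, m i / ((‖v - a i‖ - (1 + ρ₀) / ‖K‖) * ‖v - a i‖)) < ρ₀ * ‖K‖)
    (hslack : (rhoN x₀ R v + (1 + ρ₀) / ‖K‖) ^ 2 + ((j : ℝ) + 1) * (v.im + (1 + ρ₀) / ‖K‖) ^ 2 ≤ ((j : ℝ) + 1) * Hs ^ 2) :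
    ∃ u : ℂ, StTrkDQ η f x₀ s hmax R Hs B (j + 1) u :=
  succ_of_newton_door_twoPoint hE hv hK hKy hρ₀ hoff (cofactor_ne_zero_of_separated hK a m hzeros hsep) a m hm hineq hsep hS hend hslack

/-- THE SUMMABILITY INPUT of the series doors from the genus-one data (C3 g41 RESULT-7 «LAST GAP»): with the inverse-zero parametrisation
`a_n = (b n)⁻¹`, weights `m_n = [b n ≠ 0]` and `Σ ‖b n‖² < ∞` (order < 2), the z-free majorant `Σ m_n/((‖v − a_n‖ − r)‖v − a_n‖)` converges as soon as
every listed zero is farther than `r` from `v` (tail terms are `≤ 4‖b n‖²`). -/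
theorem summable_majorant_of_summable_norm_sq (b : ℕ → ℂ) (hb : Summable fun n => ‖b n‖ ^ 2) {v : ℂ} {r : ℝ} (hr : 0 ≤ r)
    (hsep : ∀ n, b n ≠ 0 → r < ‖v - (b n)⁻¹‖) :
    Summable fun n => (if b n = 0 then (0 : ℝ) else 1) / ((‖v - (b n)⁻¹‖ - r) * ‖v - (b n)⁻¹‖) := by
  set M : ℝ := 2 * (‖v‖ + r) + 1 with hM
  have hM0 : 0 < M := by rw [hM]; positivity
  have hev : ∀ᶠ n in Filter.atTop, ‖b n‖ ^ 2 < (1 / M) ^ 2 :=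
    (hb.tendsto_atTop_zero).eventually (gt_mem_nhds (by positivity))
  refine Summable.of_norm_bounded_eventually_nat (g := fun n => 4 * ‖b n‖ ^ 2) (hb.mul_left 4) ?_
  filter_upwards [hev] with n hn
  by_cases hb0 : b n = 0
  · simp [hb0]
  have hbpos : 0 < ‖b n‖ := norm_pos_iff.mpr hb0
  have hblt : ‖b n‖ < 1 / M := by
    by_contra hge
    push Not at hge
    have : (1 / M) ^ 2 ≤ ‖b n‖ ^ 2 := by gcongr
    linarith
  set a : ℂ := (b n)⁻¹ with ha
  have haM : M < ‖a‖ := by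
    rw [ha, norm_inv]
    rw [lt_inv_comm₀ hM0 hbpos]
    simpa [one_div] using hblt
  have hva : ‖a‖ - ‖v‖ ≤ ‖v - a‖ := by
    have := norm_sub_norm_le a v
    rw [norm_sub_rev] at this
    linarith [abs_sub_abs_le_abs_sub ‖a‖ ‖v‖, le_abs_self (‖a‖ - ‖v‖)]
  have h1 : ‖a‖ / 2 ≤ ‖v - a‖ - r := by linarith
  have h2 : ‖a‖ / 2 ≤ ‖v - a‖ := by linarith
  have ha0 : 0 < ‖a‖ / 2 := by linarith
  have hsp := hsep n hb0
  have hden : 0 < (‖v - a‖ - r) * ‖v - a‖ := mul_pos (by rw [ha]; linarith) (by rw [ha]; linarith [hsp])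
  simp only [hb0, if_false]
  rw [Real.norm_of_nonneg (div_nonneg zero_le_one hden.le)]
  calc 1 / ((‖v - a‖ - r) * ‖v - a‖) ≤ 1 / ((‖a‖ / 2) * (‖a‖ / 2)) :=
        one_div_le_one_div_of_le (mul_pos ha0 ha0) (mul_le_mul h1 h2 ha0.le (by linarith))
    _ = 4 * ‖b n‖ ^ 2 := by
        rw [ha, norm_inv]
        field_simp
        ring

/-- Summability of the z-free majorant from the two-point majorant AT `z = w = v` under UNIFORM separation: if `Σ' m_i/‖v − a_i‖²` converges
(C3 g41 `twoPoint_bound_dslope` at `z = w = v`), `0 ≤ r`, `0 < δ` and every positively-weighted zero satisfies `r + δ ≤ ‖v − a_i‖`, then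
`Σ' m_i/((‖v − a_i‖ − r)‖v − a_i‖)` converges (termwise factor `≤ (r+δ)/δ`). -/
theorem summable_majorant_of_uniform_sep {ι : Type*} (a : ι → ℂ) (m : ι → ℝ) (hm : ∀ i, 0 ≤ m i) {v : ℂ} {r δ : ℝ}
    (hr : 0 ≤ r) (hδ : 0 < δ) (hsep : ∀ i, 0 < m i → r + δ ≤ ‖v - a i‖)
    (hS : Summable fun i => m i / (‖v - a i‖ * ‖v - a i‖)) :
    Summable fun i => m i / ((‖v - a i‖ - r) * ‖v - a i‖) := by
  refine Summable.of_nonneg_of_le (fun i => ?_) (fun i => ?_) (hS.mul_left ((r + δ) / δ))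
  · rcases (hm i).eq_or_lt with hmi | hmi
    · rw [← hmi]; simp
    · have h := hsep i hmi
      exact div_nonneg (hm i) (mul_nonneg (by linarith) (norm_nonneg _))
  · rcases (hm i).eq_or_lt with hmi | hmi
    · rw [← hmi]; simp
    · have h := hsep i hmi
      have ht : 0 < ‖v - a i‖ := by linarith
      have htr : 0 < ‖v - a i‖ - r := by linarith
      rw [div_le_iff₀ (mul_pos htr ht)]
      -- m ≤ ((r+δ)/δ) · (m/(t·t)) · ((t − r)·t)  ⇔  δ·t ≤ (r+δ)(t − r)
      have key : δ * ‖v - a i‖ ≤ (r + δ) * (‖v - a i‖ - r) := by nlinarith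
      have : (r + δ) / δ * (m i / (‖v - a i‖ * ‖v - a i‖)) * ((‖v - a i‖ - r) * ‖v - a i‖) =
          m i * (((r + δ) * (‖v - a i‖ - r)) / (δ * ‖v - a i‖)) := by
        field_simp
      rw [this]
      have h1 : 1 ≤ ((r + δ) * (‖v - a i‖ - r)) / (δ * ‖v - a i‖) := by
        rw [le_div_iff₀ (mul_pos hδ ht)]; linarith
      nlinarith

/-- ★ UNWEIGHTED-SEPARATION form of `succ_of_newton_door_twoPoint'`, matching C3 g41's `twoPoint_bound_dslope` clauses VERBATIM (complete zero list
`∀ z, h z = 0 → ∃ i, z = a i`, weights `m ≥ 0`, two-point bound at `w = v`), with UNIFORM separation `r_N + δ ≤ ‖v − a_i‖` (which also yields the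
summability of the z-free majorant from C3's summability at `z = w = v`). -/
theorem succ_of_newton_door_twoPointU {η : ℝ} {f : ℂ → ℂ} {x₀ s hmax R Hs : ℝ} {B j : ℕ} {v : ℂ} (hE : EngineHyps5 2 η f x₀ s hmax R Hs B)
    (hv : StTrkDQ η f x₀ s hmax R Hs B j v) {K : ℂ} (hK : K ≠ 0) (hKy : 1 < ‖K‖ * v.im)
    {ρ₀ : ℝ} (hρ₀ : 0 < ρ₀) (hoff : ρ₀ / ‖K‖ ≤ |(v - K⁻¹).im|)
    {ι : Type*} (a : ι → ℂ) (m : ι → ℝ) (hm : ∀ i, 0 ≤ m i)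
    (hzeros : ∀ z, dslope (iteratedDeriv j f) v z = 0 → ∃ i, z = a i)
    (hineq : ∀ z : ℂ, ‖z - (v - K⁻¹)‖ = ρ₀ / ‖K‖ →
      ‖deriv (dslope (iteratedDeriv j f) v) z / dslope (iteratedDeriv j f) v z - K‖ ≤ ‖z - v‖ * ∑' i, m i / (‖z - a i‖ * ‖v - a i‖))
    (hSv : Summable fun i => m i / (‖v - a i‖ * ‖v - a i‖))
    {δ : ℝ} (hδ : 0 < δ) (hsep : ∀ i, (1 + ρ₀) / ‖K‖ + δ ≤ ‖v - a i‖)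
    (hend : (1 + ρ₀) * ((1 + ρ₀) / ‖K‖ * ∑' i, m i / ((‖v - a i‖ - (1 + ρ₀) / ‖K‖) * ‖v - a i‖)) < ρ₀ * ‖K‖)
    (hslack : (rhoN x₀ R v + (1 + ρ₀) / ‖K‖) ^ 2 + ((j : ℝ) + 1) * (v.im + (1 + ρ₀) / ‖K‖) ^ 2 ≤ ((j : ℝ) + 1) * Hs ^ 2) :
    ∃ u : ℂ, StTrkDQ η f x₀ s hmax R Hs B (j + 1) u := by
  have hKn : 0 < ‖K‖ := norm_pos_iff.mpr hK
  have hrN : 0 ≤ (1 + ρ₀) / ‖K‖ := by positivity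
  have hsep' : ∀ i, 0 < m i → (1 + ρ₀) / ‖K‖ < ‖v - a i‖ := fun i _ => by linarith [hsep i]
  have hh0 : ∀ z : ℂ, ‖z - (v - K⁻¹)‖ ≤ ρ₀ / ‖K‖ → dslope (iteratedDeriv j f) v z ≠ 0 := by
    intro z hz hz0
    obtain ⟨i, rfl⟩ := hzeros z hz0
    have h1 : ‖a i - v‖ ≤ (1 + ρ₀) / ‖K‖ := norm_sub_le_of_newtonDisc hK hz
    have h2 := hsep i
    rw [norm_sub_rev] at h2
    linarith
  have hS := summable_majorant_of_uniform_sep a m hm hrN hδ (fun i _ => hsep i) hSv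
  exact succ_of_newton_door_twoPoint hE hv hK hKy hρ₀ hoff hh0 a m hm hineq hsep' hS hend hslack

end RhW08.NewtonDoor
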